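import Summits.ValiantsHypothesis.ValiantsHypothesis.Theses.ImmanantSlice
import Literature.Computability.AlgebraicComplexity.ArithCircuitProjections

/-!
# Route ImmanantSlice — crux `MonotoneRigidity` (stmt-ValiantsHypothesis-10453): the
# all-ones-return gadget

The combinatorial heart of the proof of `MonotoneRigidity` (the monotone shadow of conjecture CR,
via Jerrum–Snir): a MONOTONE projection of a class-function slice
`d_χ = Σ_σ χ(σ) Π_i X_(σ i, i)` (`χ ≥ 0` a class function on `S_n`) onto a positive multiple of a
permanent. Given a derangement `β ∈ S_n` and a block `E ⊆ [n]` with `β(E) ∩ E = ∅`, enumerated by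
`fE : Fin r ≃ E`, put `A = β(E)` (`a_i = β(e_i)`). The substitution `gadgetSubst`
(entry `(x, y)` = the arc `y → x`)
* `y = a_i ∈ A`:  `X_(j, i)` if `x = β(a_j)`, else `0`;
* `y ∈ E`:        `1` if `x ∈ A`, else `0`;
* otherwise:      `1` if `x = β y`, else `0`;
keeps exactly the permutations `gadgetPerm β fE π τ = β · (β ε(π) β⁻¹) · ε(τ)` (`π, τ ∈ S_r`,
`ε = blockPerm fE` the action of `S_r` on `E`; `β ε(π) β⁻¹` is the action on `A`), with weight
`Π_i X_(π i, i)` (`prod_subst_gadgetPerm`, `exists_eq_gadgetPerm_of_ne_zero`); conjugating by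
`β ε(π) β⁻¹` shows `gadgetPerm β fE π τ ∼ gadgetPerm β fE 1 (π τ)` (`isConj_gadgetPerm`), so the
class sum `Σ_τ χ(gadgetPerm β fE π τ)` does not depend on `π`, and
`aeval (substVCFun gadgetSubst) d_χ = C W · per_r` with `W = Σ_τ χ(β ε(τ)) ≥ χ(β)`
(`aeval_gadgetSubst_slice`). This is the refuter's "all-ones return" gadget (item evidence
2026-08-17, checked there for `n ≤ 8`), made rigorous.

* `blockPerm`, `gadgetPerm`, `gadgetSubst` — the three (plumbing) definitions;
* `aeval_gadgetSubst_slice` — the projection identity.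
(The existence of a large block `E` for every derangement and the circuit bookkeeping are in the
closing file `ImmanantSliceMonotoneRigidity.lean`.)

Honest framing: bookkeeping for a NECESSARY condition of the route's conjecture CR; no statement
about VP ≠ VNP is proved and nothing here is progress on it.

## References
* M. Jerrum, M. Snir, *Some exact complexity results for straight-line computations over
  semirings*, J. ACM 29 (1982), §4.3. [JerrumSnir1982]
-/

set_option linter.dupNamespace false

noncomputable section

namespace Summit.ValiantsHypothesis.ValiantsHypothesis.Theorems.ImmanantSlice

open MvPolynomial Finset Equiv
open Literature.Computability.AlgebraicComplexity
open scoped NNReal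

variable {n r : ℕ}

/-- `f⁻¹ (f x) = x` for permutations (the coercion of `f⁻¹` is `f.symm`). [folklore] -/
private theorem perm_inv_apply_self {α : Type*} (f : Perm α) (x : α) : f⁻¹ (f x) = x :=
  f.symm_apply_apply x

/-- `f (f⁻¹ x) = x` for permutations. [folklore] -/
private theorem perm_apply_inv_self {α : Type*} (f : Perm α) (x : α) : f (f⁻¹ x) = x :=
  f.apply_symm_apply x

/-! ## The block action of `S_r` on `E ⊆ [n]` -/

/-- The permutation of `Fin n` acting by `τ ∈ S_r` on the block `E` through the enumeration `fE`
and fixing everything else. [folklore] -/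
def blockPerm (E : Finset (Fin n)) (fE : Fin r ≃ {x // x ∈ E}) (τ : Perm (Fin r)) :
    Perm (Fin n) :=
  τ.extendDomain fE

/-- The survivors of the gadget: `β · (β ε(π) β⁻¹) · ε(τ)`. [folklore] -/
def gadgetPerm (β : Perm (Fin n)) (E : Finset (Fin n)) (fE : Fin r ≃ {x // x ∈ E})
    (π τ : Perm (Fin r)) : Perm (Fin n) :=
  β * (β * blockPerm E fE π * β⁻¹) * blockPerm E fE τ

/-- The all-ones-return substitution (entry `(x, y)` = arc `y → x`; variables `X_(j,i)` on the arcs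
`a_i → β(a_j)`, constant `1` on the arcs `E → A` and `y → β y` off `A ∪ E`, `0` elsewhere).
[folklore] -/
def gadgetSubst (β : Perm (Fin n)) (E : Finset (Fin n)) (fE : Fin r ≃ {x // x ∈ E}) :
    Fin n × Fin n → (Fin r × Fin r) ⊕ ℝ≥0 := fun p =>
  if h₁ : β⁻¹ p.2 ∈ E then
    (if h₂ : β⁻¹ (β⁻¹ p.1) ∈ E then Sum.inl (fE.symm ⟨_, h₂⟩, fE.symm ⟨_, h₁⟩) else Sum.inr 0)
  else if p.2 ∈ E then (if β⁻¹ p.1 ∈ E then Sum.inr 1 else Sum.inr 0)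
  else (if p.1 = β p.2 then Sum.inr 1 else Sum.inr 0)

section Gadget

variable (β : Perm (Fin n)) (E : Finset (Fin n)) (fE : Fin r ≃ {x // x ∈ E})

/-- `ε(τ)` moves `e_i` to `e_(τ i)`. [folklore] -/
theorem blockPerm_apply_fE (τ : Perm (Fin r)) (i : Fin r) :
    blockPerm E fE τ (fE i) = fE (τ i) := by
  rw [blockPerm, Perm.extendDomain_apply_image]

/-- `ε(τ)` fixes everything outside `E`. [folklore] -/
theorem blockPerm_apply_of_not_mem (τ : Perm (Fin r)) {x : Fin n} (hx : x ∉ E) :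
    blockPerm E fE τ x = x := by
  rw [blockPerm, Perm.extendDomain_apply_not_subtype _ _ hx]

/-- `ε` is multiplicative. [folklore] -/
theorem blockPerm_mul (π τ : Perm (Fin r)) :
    blockPerm E fE (π * τ) = blockPerm E fE π * blockPerm E fE τ := by
  rw [blockPerm, blockPerm, blockPerm, Perm.extendDomain_mul]

/-- `ε(1) = 1`. [folklore] -/
theorem blockPerm_one : blockPerm E fE 1 = 1 := by
  rw [blockPerm, Perm.extendDomain_one]

variable {β E}

/-- The conjugated block action `β ε(π) β⁻¹` moves `a_i = β(e_i)` to `a_(π i)`. [folklore] -/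
theorem conjBlock_apply_a (π : Perm (Fin r)) (i : Fin r) :
    (β * blockPerm E fE π * β⁻¹) (β (fE i)) = β (fE (π i)) := by
  simp only [Perm.mul_apply, perm_inv_apply_self, blockPerm_apply_fE]

/-- The conjugated block action fixes every `x` with `β⁻¹ x ∉ E` (i.e. `x ∉ A`). [folklore] -/
theorem conjBlock_apply_of_not_mem (π : Perm (Fin r)) {x : Fin n} (hx : β⁻¹ x ∉ E) :
    (β * blockPerm E fE π * β⁻¹) x = x := by
  simp only [Perm.mul_apply, blockPerm_apply_of_not_mem E fE π hx, perm_apply_inv_self]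

/-- Values of the substitution on a column `y ∈ A` (`y = a_i`). [folklore] -/
theorem substVCFun_gadgetSubst_a (i : Fin r) (x : Fin n) :
    ArithCircuit.substVCFun (gadgetSubst β E fE) (x, β (fE i)) =
      if h : β⁻¹ (β⁻¹ x) ∈ E then (X (fE.symm ⟨_, h⟩, i) : MvPolynomial (Fin r × Fin r) ℝ≥0)
      else 0 := by
  unfold ArithCircuit.substVCFun gadgetSubst
  have h₁ : β⁻¹ (β (fE i)) ∈ E := by rw [perm_inv_apply_self]; exact (fE i).2
  simp only [h₁, dif_pos]
  split_ifs with h₂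
  · simp only [Sum.elim_inl]
    congr 2
    rw [Equiv.symm_apply_eq]
    exact Subtype.ext (perm_inv_apply_self β _)
  · simp only [Sum.elim_inr, map_zero]

/-- Values of the substitution on a column `y ∉ A ∪ E`. [folklore] -/
theorem substVCFun_gadgetSubst_of_not_mem {y : Fin n} (hy : y ∉ E) (hy' : β⁻¹ y ∉ E)
    (x : Fin n) :
    ArithCircuit.substVCFun (gadgetSubst β E fE) (x, y) =
      if x = β y then (1 : MvPolynomial (Fin r × Fin r) ℝ≥0) else 0 := by
  unfold ArithCircuit.substVCFun gadgetSubst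
  simp only [hy', dif_neg, not_false_eq_true, hy, if_false]
  split_ifs
  · simp only [Sum.elim_inr, map_one]
  · simp only [Sum.elim_inr, map_zero]

/-- The class sum dominates `χ(β)` (the survivor `gadgetPerm 1 1 = β`). [folklore] -/
theorem le_classSum (χ : Perm (Fin n) → ℝ≥0) :
    χ β ≤ ∑ τ : Perm (Fin r), χ (gadgetPerm β E fE 1 τ) := by
  classical
  have h1 : gadgetPerm β E fE 1 1 = β := by
    rw [gadgetPerm, blockPerm_one]; group
  calc χ β = χ (gadgetPerm β E fE 1 1) := by rw [h1]
    _ ≤ ∑ τ : Perm (Fin r), χ (gadgetPerm β E fE 1 τ) :=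
        Finset.single_le_sum (f := fun τ => χ (gadgetPerm β E fE 1 τ)) (fun _ _ => zero_le)
          (Finset.mem_univ (1 : Perm (Fin r)))

variable (hE : ∀ x ∈ E, β x ∉ E)
include hE

/-- `β⁻¹` also maps `E` off `E`. [folklore] -/
theorem inv_apply_not_mem {x : Fin n} (hx : x ∈ E) : β⁻¹ x ∉ E := by
  intro h
  have := hE _ h
  rw [perm_apply_inv_self] at this
  exact this hx

/-- The two block actions commute (disjoint supports `A` and `E`). [folklore] -/
theorem conjBlock_mul_blockPerm_comm (π τ : Perm (Fin r)) :
    (β * blockPerm E fE π * β⁻¹) * blockPerm E fE τ =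
      blockPerm E fE τ * (β * blockPerm E fE π * β⁻¹) := by
  refine (Perm.Disjoint.commute fun x => ?_).eq
  by_cases hx : β⁻¹ x ∈ E
  · right
    refine blockPerm_apply_of_not_mem E fE τ fun hxE => ?_
    exact inv_apply_not_mem hE hxE hx
  · left
    exact conjBlock_apply_of_not_mem fE π hx

/-- A survivor on `E`: `e_i ↦ a_(τ i) = β(e_(τ i))`. [folklore] -/
theorem gadgetPerm_apply_fE (π τ : Perm (Fin r)) (i : Fin r) :
    gadgetPerm β E fE π τ (fE i) = β (fE (τ i)) := by
  rw [gadgetPerm, Perm.mul_apply, Perm.mul_apply, blockPerm_apply_fE,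
    conjBlock_apply_of_not_mem fE π (inv_apply_not_mem hE (fE (τ i)).2)]

/-- A survivor on `A`: `a_i = β(e_i) ↦ β(a_(π i))`. [folklore] -/
theorem gadgetPerm_apply_a (π τ : Perm (Fin r)) (i : Fin r) :
    gadgetPerm β E fE π τ (β (fE i)) = β (β (fE (π i))) := by
  rw [gadgetPerm, Perm.mul_apply, Perm.mul_apply,
    blockPerm_apply_of_not_mem E fE τ (hE _ (fE i).2), conjBlock_apply_a fE π i]

omit hE in
/-- A survivor off `A ∪ E` agrees with `β`. [folklore] -/
theorem gadgetPerm_apply_of_not_mem (π τ : Perm (Fin r)) {y : Fin n} (hy : y ∉ E)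
    (hy' : β⁻¹ y ∉ E) : gadgetPerm β E fE π τ y = β y := by
  rw [gadgetPerm, Perm.mul_apply, Perm.mul_apply, blockPerm_apply_of_not_mem E fE τ hy,
    conjBlock_apply_of_not_mem fE π hy']

/-- **Conjugacy of the survivors**: `gadgetPerm π τ` is conjugate (by `β ε(π) β⁻¹`) to
`gadgetPerm 1 (π τ) = β ε(π τ)`. [folklore] -/
theorem isConj_gadgetPerm (π τ : Perm (Fin r)) :
    IsConj (gadgetPerm β E fE π τ) (gadgetPerm β E fE 1 (π * τ)) := by
  refine isConj_iff.2 ⟨β * blockPerm E fE π * β⁻¹, ?_⟩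
  have hcomm := conjBlock_mul_blockPerm_comm fE hE π τ
  rw [gadgetPerm, gadgetPerm, blockPerm_one, blockPerm_mul]
  -- `c (β c ε) c⁻¹ = c β ε c c⁻¹ = c β ε = β ε(π) β⁻¹ β ε(τ) = β ε(π) ε(τ)`
  calc β * blockPerm E fE π * β⁻¹ * (β * (β * blockPerm E fE π * β⁻¹) * blockPerm E fE τ) *
        (β * blockPerm E fE π * β⁻¹)⁻¹
      = β * blockPerm E fE π * β⁻¹ * β * ((β * blockPerm E fE π * β⁻¹) * blockPerm E fE τ) *
        (β * blockPerm E fE π * β⁻¹)⁻¹ := by group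
    _ = β * blockPerm E fE π * β⁻¹ * β * (blockPerm E fE τ * (β * blockPerm E fE π * β⁻¹)) *
        (β * blockPerm E fE π * β⁻¹)⁻¹ := by rw [hcomm]
    _ = β * (β * 1 * β⁻¹) * (blockPerm E fE π * blockPerm E fE τ) := by group

/-- **Injectivity**: the pair `(π, τ)` is determined by the survivor. [folklore] -/
theorem gadgetPerm_injective {π τ π' τ' : Perm (Fin r)}
    (h : gadgetPerm β E fE π τ = gadgetPerm β E fE π' τ') : π = π' ∧ τ = τ' := by
  constructor
  · ext i
    have h1 := congrArg (fun g : Perm (Fin n) => g (β (fE i))) h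
    simp only [gadgetPerm_apply_a fE hE] at h1
    exact congrArg Fin.val (fE.injective (Subtype.ext (β.injective (β.injective h1))))
  · ext i
    have h1 := congrArg (fun g : Perm (Fin n) => g (fE i)) h
    simp only [gadgetPerm_apply_fE fE hE] at h1
    exact congrArg Fin.val (fE.injective (Subtype.ext (β.injective h1)))

/-! ## The substitution -/

/-- Values of the substitution on a column `y ∈ E` (`y = e_i`). [folklore] -/
theorem substVCFun_gadgetSubst_fE (i : Fin r) (x : Fin n) :
    ArithCircuit.substVCFun (gadgetSubst β E fE) (x, (fE i : Fin n)) =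
      if β⁻¹ x ∈ E then (1 : MvPolynomial (Fin r × Fin r) ℝ≥0) else 0 := by
  unfold ArithCircuit.substVCFun gadgetSubst
  have h₁ : β⁻¹ (fE i : Fin n) ∉ E := inv_apply_not_mem hE (fE i).2
  simp only [h₁, dif_neg, not_false_eq_true, (fE i).2, if_true]
  split_ifs
  · simp only [Sum.elim_inr, map_one]
  · simp only [Sum.elim_inr, map_zero]

/-- **The weight of a survivor** is the permanent monomial `Π_i X_(π i, i)`. [folklore] -/
theorem prod_subst_gadgetPerm (π τ : Perm (Fin r)) :
    ∏ y : Fin n, ArithCircuit.substVCFun (gadgetSubst β E fE) (gadgetPerm β E fE π τ y, y) =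
      ∏ i : Fin r, (X (π i, i) : MvPolynomial (Fin r × Fin r) ℝ≥0) := by
  classical
  -- only the columns in `A = β(E)` carry a factor `≠ 1`
  rw [← Finset.prod_subset (Finset.subset_univ (E.map β.toEmbedding))]
  · -- the `A`-columns, reindexed by `fE`
    have hcol : ∀ i : Fin r, (X (π i, i) : MvPolynomial (Fin r × Fin r) ℝ≥0) =
        ArithCircuit.substVCFun (gadgetSubst β E fE)
          (gadgetPerm β E fE π τ (β.toEmbedding (fE i)), β.toEmbedding (fE i)) := by
      intro i
      rw [Equiv.toEmbedding_apply, gadgetPerm_apply_a fE hE, substVCFun_gadgetSubst_a]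
      have h : β⁻¹ (β⁻¹ (β (β (fE (π i) : Fin n)))) ∈ E := by
        rw [perm_inv_apply_self, perm_inv_apply_self]; exact (fE (π i)).2
      rw [dif_pos h]
      congr 2
      symm
      rw [Equiv.symm_apply_eq]
      refine Subtype.ext ?_
      show β⁻¹ (β⁻¹ (β (β _))) = _
      rw [perm_inv_apply_self, perm_inv_apply_self]
    calc ∏ y ∈ E.map β.toEmbedding, ArithCircuit.substVCFun (gadgetSubst β E fE)
            (gadgetPerm β E fE π τ y, y)
        = ∏ x ∈ E, ArithCircuit.substVCFun (gadgetSubst β E fE)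
            (gadgetPerm β E fE π τ (β.toEmbedding x), β.toEmbedding x) := Finset.prod_map _ _ _
      _ = ∏ x : {x // x ∈ E}, ArithCircuit.substVCFun (gadgetSubst β E fE)
            (gadgetPerm β E fE π τ (β.toEmbedding x), β.toEmbedding x) :=
          (Finset.prod_coe_sort E _).symm
      _ = ∏ i : Fin r, (X (π i, i) : MvPolynomial (Fin r × Fin r) ℝ≥0) :=
          (Fintype.prod_equiv fE _ _ hcol).symm
  · intro y _ hyA
    have hy' : β⁻¹ y ∉ E := by
      intro h
      exact hyA (Finset.mem_map.2 ⟨β⁻¹ y, h, by simp⟩)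
    by_cases hyE : y ∈ E
    · have : y = (fE (fE.symm ⟨y, hyE⟩) : Fin n) := by simp
      rw [this, gadgetPerm_apply_fE fE hE, substVCFun_gadgetSubst_fE fE hE, perm_inv_apply_self,
        if_pos (fE _).2]
    · rw [gadgetPerm_apply_of_not_mem fE π τ hyE hy',
        substVCFun_gadgetSubst_of_not_mem fE hyE hy', if_pos rfl]

/-- **Survivors**: a permutation all of whose gadget factors are non-zero is a `gadgetPerm`.
[folklore] -/
theorem exists_eq_gadgetPerm_of_ne_zero (σ : Perm (Fin n))
    (h : ∀ y : Fin n, ArithCircuit.substVCFun (gadgetSubst β E fE) (σ y, y) ≠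
      (0 : MvPolynomial (Fin r × Fin r) ℝ≥0)) :
    ∃ π τ : Perm (Fin r), σ = gadgetPerm β E fE π τ := by
  classical
  -- read `τ` off `E`
  have hτ : ∀ i : Fin r, β⁻¹ (σ (fE i)) ∈ E := by
    intro i
    have := h (fE i)
    rw [substVCFun_gadgetSubst_fE fE hE] at this
    by_contra hc
    exact this (if_neg hc)
  -- read `π` off `A`
  have hπ : ∀ i : Fin r, β⁻¹ (β⁻¹ (σ (β (fE i)))) ∈ E := by
    intro i
    have := h (β (fE i))
    rw [substVCFun_gadgetSubst_a] at this
    by_contra hc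
    exact this (dif_neg hc)
  -- the other columns follow `β`
  have hrest : ∀ y : Fin n, y ∉ E → β⁻¹ y ∉ E → σ y = β y := by
    intro y hy hy'
    have := h y
    rw [substVCFun_gadgetSubst_of_not_mem fE hy hy'] at this
    by_contra hc
    exact this (if_neg hc)
  let τf : Fin r → Fin r := fun i => fE.symm ⟨_, hτ i⟩
  let πf : Fin r → Fin r := fun i => fE.symm ⟨_, hπ i⟩
  have hτf : ∀ i, (fE (τf i) : Fin n) = β⁻¹ (σ (fE i)) := fun i => by simp [τf]
  have hπf : ∀ i, (fE (πf i) : Fin n) = β⁻¹ (β⁻¹ (σ (β (fE i)))) := fun i => by simp [πf]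
  have hτinj : Function.Injective τf := by
    intro i j hij
    have := congrArg (fun k => (fE k : Fin n)) hij
    simp only [hτf] at this
    exact fE.injective (Subtype.ext (σ.injective (β⁻¹.injective this)))
  have hπinj : Function.Injective πf := by
    intro i j hij
    have := congrArg (fun k => (fE k : Fin n)) hij
    simp only [hπf] at this
    exact fE.injective (Subtype.ext (β.injective (σ.injective
      (β⁻¹.injective (β⁻¹.injective this)))))
  refine ⟨Equiv.ofBijective πf (Finite.injective_iff_bijective.1 hπinj),
    Equiv.ofBijective τf (Finite.injective_iff_bijective.1 hτinj), ?_⟩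
  ext y
  by_cases hyA : β⁻¹ y ∈ E
  · -- `y = a_i`
    have hy : y = β (fE (fE.symm ⟨β⁻¹ y, hyA⟩)) := by simp
    rw [hy, gadgetPerm_apply_a fE hE, Equiv.ofBijective_apply, hπf, perm_apply_inv_self,
      perm_apply_inv_self]
  · by_cases hyE : y ∈ E
    · have hy : y = (fE (fE.symm ⟨y, hyE⟩) : Fin n) := by simp
      rw [hy, gadgetPerm_apply_fE fE hE, Equiv.ofBijective_apply, hτf, perm_apply_inv_self]
    · rw [gadgetPerm_apply_of_not_mem fE _ _ hyE hyA, hrest y hyE hyA]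

/-- **The projection identity**: for a class function `χ` on `S_n`,
`aeval (gadget substitution) (Σ_σ χ(σ) Π_i X_(σ i, i)) = C W · per_r` with the class sum
`W = Σ_τ χ(β ε(τ))` (independent of the `A`-coordinate `π` by `isConj_gadgetPerm`). [folklore] -/
theorem aeval_gadgetSubst_slice (χ : Perm (Fin n) → ℝ≥0)
    (hχ : ∀ σ τ : Perm (Fin n), IsConj σ τ → χ σ = χ τ) :
    aeval (ArithCircuit.substVCFun (gadgetSubst β E fE))
        (∑ σ : Perm (Fin n), C (χ σ) * ∏ i : Fin n, X (σ i, i)) =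
      C (∑ τ : Perm (Fin r), χ (gadgetPerm β E fE 1 τ)) *
        ∑ π : Perm (Fin r), ∏ i : Fin r, (X (π i, i) : MvPolynomial (Fin r × Fin r) ℝ≥0) := by
  classical
  simp only [map_sum, map_mul, aeval_C, map_prod, aeval_X, algebraMap_eq]
  -- the summand vanishes off the image of `gadgetPerm`
  set F : Perm (Fin n) → MvPolynomial (Fin r × Fin r) ℝ≥0 := fun σ =>
    C (χ σ) * ∏ y, ArithCircuit.substVCFun (gadgetSubst β E fE) (σ y, y) with hF
  set Φ : Perm (Fin r) × Perm (Fin r) → Perm (Fin n) := fun p => gadgetPerm β E fE p.1 p.2 with hΦ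
  have hΦinj : Set.InjOn Φ ↑((Finset.univ : Finset (Perm (Fin r))) ×ˢ
      (Finset.univ : Finset (Perm (Fin r)))) := by
    rintro ⟨π, τ⟩ - ⟨π', τ'⟩ - hpt
    obtain ⟨h1, h2⟩ := gadgetPerm_injective fE hE hpt
    exact Prod.ext h1 h2
  have hsupp : ∀ σ ∈ (Finset.univ : Finset (Perm (Fin n))),
      σ ∉ (Finset.univ ×ˢ Finset.univ).image Φ → F σ = 0 := by
    intro σ _ hσ
    have : ¬ ∀ y : Fin n, ArithCircuit.substVCFun (gadgetSubst β E fE) (σ y, y) ≠ 0 := by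
      intro hall
      obtain ⟨π, τ, rfl⟩ := exists_eq_gadgetPerm_of_ne_zero fE hE σ hall
      exact hσ (Finset.mem_image.2 ⟨(π, τ), by simp, rfl⟩)
    push Not at this
    obtain ⟨y, hy⟩ := this
    rw [hF]
    simp only
    rw [Finset.prod_eq_zero (Finset.mem_univ y) hy, mul_zero]
  rw [← Finset.sum_subset (Finset.subset_univ _) hsupp, Finset.sum_image hΦinj,
    Finset.sum_product]
  simp only [hF, hΦ, prod_subst_gadgetPerm fE hE]
  rw [Finset.mul_sum]
  refine Finset.sum_congr rfl fun π _ => ?_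
  rw [← Finset.sum_mul]
  congr 1
  -- the class sum does not depend on `π`
  calc ∑ τ, C (χ (gadgetPerm β E fE π τ))
      = ∑ τ, (C (χ (gadgetPerm β E fE 1 (π * τ))) : MvPolynomial (Fin r × Fin r) ℝ≥0) :=
        Finset.sum_congr rfl fun τ _ => by rw [hχ _ _ (isConj_gadgetPerm fE hE π τ)]
    _ = ∑ τ, C (χ (gadgetPerm β E fE 1 τ)) :=
        Fintype.sum_equiv (Equiv.mulLeft π) _ _ fun τ => rfl

end Gadget

end Summit.ValiantsHypothesis.ValiantsHypothesis.Theorems.ImmanantSlice
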